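import Literature.Analysis.FluidPDE.PassiveVectorVarTensorL2WeakSlice
import Literature.Analysis.FluidPDE.PassiveVectorVarTensorLionsWeak
import Literature.Analysis.FluidPDE.PassiveVectorTensorL2WeakBound
import Literature.Analysis.FluidPDE.PassiveVectorTensorDistortedDuality
import Literature.Analysis.FluidPDE.DissipationAnomalyProofs
import HarnessLib

/-!
# `L²ₜH¹ₓ` distributional solutions of the VARIABLE-tensor passive-vector equation are in `L^∞_t L²_x`

Analysis/FluidPDE proof-support file (everything proved; no definitions, no named facts). Variable-tensor
twin of `PassiveVectorTensorL2WeakBound`: the first pass of the truncated (Galerkin) energy argument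
(Robinson–Rodrigo–Sadowski 2016, §4.2 (4.20)) for an `L²((0,T) × T^d)` distributional solution `w` of
`∂ₜw + (b·∇)w + ∇π = ∇·(𝔹(t,y)∇w)`, `∇·w = 0` (weak formulation against divergence-free space–time tests,
bounded carrier, divergence-free `L²` datum, divergence-free `L²` slices) **which carries a weak space
gradient in `L²`** — the class produced by J.-L. Lions' theorem run in the graph space
(`PassiveVectorVarTensorLionsGraph` + `PassiveVectorVarTensorLionsGradient`). For `NearIso 𝔸 lo hi`,
`lo > 0`, and a coefficient field entrywise `δ`-close to `𝔸` it yields, for a.e. `t`,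
`∫‖w(t)‖² ≤ ‖w₀‖² + (4d²M²/lo)‖w‖²_{L²(μ_T)} + (d⁴δ²/lo) Σ_c ‖∂_c w‖²_{L²(μ_T)}`
(`ae_integral_norm_sq_le_of_weakVar`).

Why the weak gradient is needed (and how it enters): the viscous pairing against the own truncation,
`∫⟪w, 𝓛^{𝔹,*} P_N w⟫`, no longer reduces to the truncation (the variable tensor couples the Fourier
modes). It is split as `𝔹 = 𝔸 + (𝔹 − 𝔸)`: the constant part is the truncated Gårding inequality of the
constant-tensor file (`integral_inner_viscAdj_fourierTruncate_le`: `≤ −lo‖∇P_N w‖²`), and the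
perturbation is moved onto the WEAK GRADIENT of `w` (`integral_inner_viscAdjVar_eq_neg_integral_sum`:
`∫⟪w, 𝓛^{𝔹−𝔸,*}ψ⟫ = −∫ (𝔹−𝔸) ∇ψ · ∇w`), bounded entrywise by `d²δ |∇P_N w| |∇w|` and absorbed by
Young's inequality into `½lo‖∇P_N w‖² + (d⁴δ²/2lo)‖∇w(τ)‖²`.

* `sum_mul_varTensorFlux_eq` — linearity of the flux `ψ ↦ ∫⟪v,(u·∇)ψ + 𝓛^{𝔹,*}ψ⟫` over finite sums;
* `abs_integral_inner_viscAdjVar_le_of_hasWeakPartialDeriv` — the perturbative viscous pairing against the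
  weak gradient;
* `ae_integral_norm_sq_le_of_weakVar` — the `L^∞_t L²_x` bound.

## References

* J. C. Robinson, J. L. Rodrigo, W. Sadowski, *The three-dimensional Navier–Stokes equations* (CUP 2016),
  §4.2 (4.20). [`RobinsonRodrigoSadowski2016`]
* J.-L. Lions, E. Magenes, *Non-homogeneous boundary value problems and applications* I (1972), Chap. 3,
  Thm. 1.1, §4.3–§4.4. [`LionsMagenes1972`]
* M. Giaquinta, *Multiple integrals in the calculus of variations* (Princeton 1983), Ch. III §2. [`Giaquinta1983MultipleIntegrals`]
-/

noncomputable section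

open MeasureTheory Set Filter Function TopologicalSpace Complex UnitAddTorus
open scoped ENNReal NNReal InnerProductSpace Topology ComplexConjugate

namespace Literature.Analysis.FluidPDE

namespace Torus

variable {d : Type*} [Fintype d] [DecidableEq d]

/-! ## Linearity of the variable-tensor flux in the test field -/

/-- `viscAdjVar 𝔹` of the zero field vanishes. [folklore] -/
private theorem viscAdjVar_zero_field_V4 (𝔹 : UnitAddTorus d → Visc4 d) (x : UnitAddTorus d) :
    viscAdjVar 𝔹 (fun _ => (0 : EuclideanSpace ℝ d)) x = 0 := by
  have h0 : FunctionSpaces.Torus.IsContDiff 1 (fun _ : UnitAddTorus d => (0 : EuclideanSpace ℝ d)) :=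
    (FunctionSpaces.Torus.isSmooth_const _).isContDiff (by simp)
  have h := viscAdjVar_const_smul 𝔹 h0 0 x
  simp only [zero_smul] at h
  exact h

/-- `viscAdjVar 𝔹` over a finite linear combination of smooth fields. [folklore] -/
private theorem viscAdjVar_finset_sum_smul_V4 {ι : Type*} {𝔹 : UnitAddTorus d → Visc4 d}
    (h𝔹 : ∀ i c j e, FunctionSpaces.Torus.IsSmooth (fun y => 𝔹 y i c j e)) (s : Finset ι) (c : ι → ℝ)
    {a : ι → UnitAddTorus d → EuclideanSpace ℝ d} (ha : ∀ i, FunctionSpaces.Torus.IsSmooth (a i)) (x : UnitAddTorus d) :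
    viscAdjVar 𝔹 (fun y => ∑ i ∈ s, c i • a i y) x = ∑ i ∈ s, c i • viscAdjVar 𝔹 (a i) x := by
  classical
  induction s using Finset.induction_on with
  | empty =>
    simp only [Finset.sum_empty]
    exact viscAdjVar_zero_field_V4 𝔹 x
  | insert j s hj ih =>
    have e : (fun y => ∑ i ∈ insert j s, c i • a i y) = (c j • a j) + fun y => ∑ i ∈ s, c i • a i y := by
      funext y; rw [Finset.sum_insert hj]; rfl
    rw [e, viscAdjVar_add_field h𝔹 ((ha j).smul (c j)) (isSmooth_finset_sum_smul s c ha) x, ih,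
      show viscAdjVar 𝔹 (c j • a j) x = c j • viscAdjVar 𝔹 (a j) x from
        viscAdjVar_const_smul 𝔹 ((ha j).isContDiff (by simp)) (c j) x, Finset.sum_insert hj]

/-- **Linearity of the variable-tensor flux in the test field**: for smooth `aᵢ`, reals `cᵢ` and
`Ψ = ∑ᵢ cᵢ aᵢ`, `∑ᵢ cᵢ ∫⟪v,(u·∇)aᵢ + 𝓛^{𝔹,*}aᵢ⟫ = ∫⟪v,(u·∇)Ψ + 𝓛^{𝔹,*}Ψ⟫` (`v` integrable, products
`uⱼ v` integrable, `𝔹` with smooth entries). [cite: RobinsonRodrigoSadowski2016, §4.1 (Galerkin truncations)] -/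
theorem sum_mul_varTensorFlux_eq {ι : Type*} (I : Finset ι) (c : ι → ℝ)
    {a : ι → UnitAddTorus d → EuclideanSpace ℝ d} (ha : ∀ i, FunctionSpaces.Torus.IsSmooth (a i))
    {𝔹 : UnitAddTorus d → Visc4 d} (h𝔹 : ∀ i c j e, FunctionSpaces.Torus.IsSmooth (fun y => 𝔹 y i c j e))
    {u v : UnitAddTorus d → EuclideanSpace ℝ d} (hv : Integrable v volume)
    (huv : ∀ j, Integrable (fun x => u x j • v x) volume) :
    ∑ i ∈ I, c i * ∫ x, ⟪v x, FunctionSpaces.Torus.convect u (a i) x + viscAdjVar 𝔹 (a i) x⟫_ℝ =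
      ∫ x, ⟪v x, FunctionSpaces.Torus.convect u (fun y => ∑ i ∈ I, c i • a i y) x +
          viscAdjVar 𝔹 (fun y => ∑ i ∈ I, c i • a i y) x⟫_ℝ := by
  have hΨ : FunctionSpaces.Torus.IsSmooth (fun y => ∑ i ∈ I, c i • a i y) := isSmooth_finset_sum_smul I c ha
  have iV : ∀ {Φ : UnitAddTorus d → EuclideanSpace ℝ d}, FunctionSpaces.Torus.IsSmooth Φ →
      Integrable (fun x => ⟪v x, viscAdjVar 𝔹 Φ x⟫_ℝ) volume := fun hΦ =>
    FunctionSpaces.Torus.integrable_inner_of_continuous hv (isSmooth_viscAdjVar h𝔹 hΦ).continuous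
  have split : ∀ {Φ : UnitAddTorus d → EuclideanSpace ℝ d}, FunctionSpaces.Torus.IsSmooth Φ →
      ∫ x, ⟪v x, FunctionSpaces.Torus.convect u Φ x + viscAdjVar 𝔹 Φ x⟫_ℝ =
        (∫ x, ⟪v x, FunctionSpaces.Torus.convect u Φ x⟫_ℝ) + ∫ x, ⟪v x, viscAdjVar 𝔹 Φ x⟫_ℝ := by
    intro Φ hΦ
    rw [← integral_add (integrable_inner_convect_of_integrable_smul huv hΦ) (iV hΦ)]
    exact integral_congr_ae (ae_of_all _ fun x => inner_add_right _ _ _)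
  rw [split hΨ, ← sum_mul_integral_inner_convect_eq I c ha huv]
  have hvisc : ∑ i ∈ I, c i * ∫ x, ⟪v x, viscAdjVar 𝔹 (a i) x⟫_ℝ =
      ∫ x, ⟪v x, viscAdjVar 𝔹 (fun y => ∑ i ∈ I, c i • a i y) x⟫_ℝ := by
    simp_rw [← integral_const_mul]
    rw [← integral_finsetSum I fun i _ => (iV (ha i)).const_mul _]
    refine integral_congr_ae (ae_of_all _ fun x => ?_)
    dsimp only
    rw [viscAdjVar_finset_sum_smul_V4 h𝔹 I c ha x, inner_sum]
    exact Finset.sum_congr rfl fun i _ => by rw [real_inner_smul_right]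
  simp_rw [split (ha _)]
  rw [Finset.sum_congr rfl fun i _ => mul_add (c i) _ _, Finset.sum_add_distrib, hvisc]

/-! ## The perturbative viscous pairing against a weak gradient -/

/-- `∑ᵢ vᵢ eᵢ = v` in `ℝ^d`. [folklore] -/
private theorem sum_apply_smul_single_V4 (v : EuclideanSpace ℝ d) :
    ∑ i, v i • EuclideanSpace.single i (1 : ℝ) = v := by
  ext i'
  simp [Finset.sum_apply, Pi.single_apply]

/-- Young's inequality in the form `κ √A √B ≤ (lo/2) A + (κ²/(2 lo)) B` (`A, B ≥ 0`, `lo > 0`). [folklore] -/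
private theorem young_sqrt_V4 {lo κ A B : ℝ} (hlo : 0 < lo) (hA : 0 ≤ A) (hB : 0 ≤ B) :
    κ * Real.sqrt A * Real.sqrt B ≤ lo / 2 * A + κ ^ 2 / (2 * lo) * B := by
  have hsA := Real.sq_sqrt hA
  have hsB := Real.sq_sqrt hB
  rw [show lo / 2 * A + κ ^ 2 / (2 * lo) * B = (lo ^ 2 * A + κ ^ 2 * B) / (2 * lo) by field_simp,
    le_div_iff₀ (by positivity)]
  nlinarith [sq_nonneg (lo * Real.sqrt A - κ * Real.sqrt B), hsA, hsB]

/-- **The perturbative viscous pairing is controlled by the weak gradient.** For a coefficient field `ℙ`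
with smooth entries bounded by `δ ≥ 0`, a smooth field `ψ`, and `v ∈ L²(T^d)` with weak partial
derivatives `G c ∈ L²` (`Torus.HasWeakPartialDeriv c v (G c)` for every `c`):
`|∫⟪v, 𝓛^{ℙ,*}ψ⟫| ≤ (lo/2)‖∇ψ‖₂² + (d⁴δ²/(2lo)) ∫ Σ_c ‖G c‖²` for every `lo > 0` (move `𝓛^{ℙ,*}` onto the
weak gradient, `integral_inner_viscAdjVar_eq_neg_integral_sum`; entrywise bound
`Visc4.form_bound_of_entry_bound`; Young). [cite: Giaquinta1983MultipleIntegrals, Ch. III §2 eq. (2.2)–(2.6)] -/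
theorem abs_integral_inner_viscAdjVar_le_of_hasWeakPartialDeriv {ℙ : UnitAddTorus d → Visc4 d}
    (hℙ : ∀ i c j e, FunctionSpaces.Torus.IsSmooth (fun y => ℙ y i c j e)) {δ : ℝ} (hδ0 : 0 ≤ δ)
    (hδ : ∀ y i c j e, |ℙ y i c j e| ≤ δ)
    {ψ : UnitAddTorus d → EuclideanSpace ℝ d} (hψ : FunctionSpaces.Torus.IsSmooth ψ)
    {v : UnitAddTorus d → EuclideanSpace ℝ d} (hv : MemLp v 2 volume)
    {G : d → UnitAddTorus d → EuclideanSpace ℝ d} (hG : ∀ c, FunctionSpaces.Torus.HasWeakPartialDeriv c v (G c))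
    (hG2 : ∀ c, MemLp (G c) 2 volume) {lo : ℝ} (hlo : 0 < lo) :
    |∫ x, ⟪v x, viscAdjVar ℙ ψ x⟫_ℝ| ≤
      lo / 2 * FunctionSpaces.Torus.gradNormSq ψ +
        ((Fintype.card d : ℝ) ^ 2 * δ) ^ 2 / (2 * lo) * ∫ x, ∑ c, ‖G c x‖ ^ 2 := by
  -- package the weak partial derivatives as a weak gradient
  set Gm : UnitAddTorus d → EuclideanSpace ℝ d →L[ℝ] EuclideanSpace ℝ d := fun x =>
    ∑ i, ∑ j, (G j x i) • (EuclideanSpace.proj j : EuclideanSpace ℝ d →L[ℝ] ℝ).smulRight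
      (EuclideanSpace.single i (1 : ℝ)) with hGm
  have hGapp : ∀ x e, Gm x (EuclideanSpace.single e 1) = G e x := by
    intro x e
    rw [hGm, sum_smul_smulRight_apply_single (fun i j => G j x i) e, sum_apply_smul_single_V4]
  have hWG : HasWeakGradient v Gm := by
    intro e
    rw [show (fun x => Gm x (EuclideanSpace.single e 1)) = G e from funext fun x => hGapp x e]
    exact hG e
  have hGi : Integrable Gm volume :=
    integrable_sum_smul_smulRight fun i j => ((hG2 j).integrable one_le_two).eval_piLp i
  have hvi : Integrable v volume := hv.integrable one_le_two
  rw [integral_inner_viscAdjVar_eq_neg_integral_sum hℙ hψ hvi hWG hGi, abs_neg]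
  simp_rw [hGapp]
  -- pointwise: entrywise bound and Young
  set A : UnitAddTorus d → ℝ := fun x => ∑ c, ∑ i, (FunctionSpaces.Torus.partialDeriv c ψ x) i ^ 2 with hA
  set B : UnitAddTorus d → ℝ := fun x => ∑ e, ∑ l, (G e x) l ^ 2 with hB
  set κ : ℝ := (Fintype.card d : ℝ) ^ 2 * δ with hκ
  have hpt : ∀ x, |∑ l, ∑ i, ∑ c, ∑ e, ℙ x i c l e * (FunctionSpaces.Torus.partialDeriv c ψ x) i * (G e x) l| ≤
      lo / 2 * A x + κ ^ 2 / (2 * lo) * B x := by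
    intro x
    have h := Visc4.form_bound_of_entry_bound hδ0 hδ x (fun c i => (FunctionSpaces.Torus.partialDeriv c ψ x) i)
      (fun e l => (G e x) l)
    exact h.trans (young_sqrt_V4 hlo (Finset.sum_nonneg fun _ _ => Finset.sum_nonneg fun _ _ => sq_nonneg _)
      (Finset.sum_nonneg fun _ _ => Finset.sum_nonneg fun _ _ => sq_nonneg _))
  -- integrability of `A`, `B`
  have hAi : Integrable A volume := by
    refine integrable_finsetSum _ fun c _ => integrable_finsetSum _ fun i _ => ?_
    have hc : Continuous (fun x => (FunctionSpaces.Torus.partialDeriv c ψ x) i) :=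
      (PiLp.continuous_apply 2 _ i).comp (hψ.partialDeriv c).continuous
    have hc2 : Continuous (fun x => (FunctionSpaces.Torus.partialDeriv c ψ x) i ^ 2) := hc.pow 2
    exact hc2.integrable_of_hasCompactSupport (HasCompactSupport.of_compactSpace _)
  have hBi : Integrable B volume := by
    refine integrable_finsetSum _ fun e _ => integrable_finsetSum _ fun l _ => ?_
    have h2 : MemLp (fun x => (G e x) l) 2 volume := (hG2 e).eval_piLp l
    have h3 := h2.integrable_norm_pow two_ne_zero
    simp only [Real.norm_eq_abs, sq_abs] at h3
    exact h3
  have hAeq : ∫ x, A x = FunctionSpaces.Torus.gradNormSq ψ := by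
    rw [gradNormSq_eq_integral_sum_sum_sq]
    exact integral_congr_ae (ae_of_all _ fun x => Finset.sum_comm)
  have hBeq : ∫ x, B x = ∫ x, ∑ c, ‖G c x‖ ^ 2 := by
    refine integral_congr_ae (ae_of_all _ fun x => ?_)
    simp only [hB, EuclideanSpace.norm_sq_eq, Real.norm_eq_abs, sq_abs]
  calc |∫ x, ∑ l, ∑ i, ∑ c, ∑ e, ℙ x i c l e * (FunctionSpaces.Torus.partialDeriv c ψ x) i * (G e x) l|
      ≤ ∫ x, |∑ l, ∑ i, ∑ c, ∑ e, ℙ x i c l e * (FunctionSpaces.Torus.partialDeriv c ψ x) i * (G e x) l| :=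
        abs_integral_le_integral_abs
    _ ≤ ∫ x, (lo / 2 * A x + κ ^ 2 / (2 * lo) * B x) :=
        integral_mono_of_nonneg (ae_of_all _ fun x => abs_nonneg _) ((hAi.const_mul _).add (hBi.const_mul _))
          (ae_of_all _ hpt)
    _ = lo / 2 * FunctionSpaces.Torus.gradNormSq ψ + κ ^ 2 / (2 * lo) * ∫ x, ∑ c, ‖G c x‖ ^ 2 := by
        rw [integral_add (hAi.const_mul _) (hBi.const_mul _), integral_const_mul, integral_const_mul, hAeq, hBeq]

/-! ## The `L^∞_t L²_x` bound -/

section L2Bound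

variable {T : ℝ} {𝔸 : Visc4 d} {𝔹 : ℝ → UnitAddTorus d → Visc4 d}
  {b w : ℝ → UnitAddTorus d → EuclideanSpace ℝ d} {w₀ : UnitAddTorus d → EuclideanSpace ℝ d}
  {Gw : ℝ → d → UnitAddTorus d → EuclideanSpace ℝ d}

omit [Fintype d] [DecidableEq d] in
/-- Product rule for an a.e. primitive with datum (copy of the private lemma of the constant-tensor file). [folklore] -/
private theorem ae_sq_eq_of_ae_eq_add_setIntegral_V4 {T c : ℝ} {U F : ℝ → ℝ} (hF : IntegrableOn F (Ioo 0 T) volume)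
    (hU : ∀ᵐ t ∂(volume.restrict (Ioo 0 T)), U t = c + ∫ τ in Ioc 0 t, F τ) :
    ∀ᵐ t ∂(volume.restrict (Ioo 0 T)), U t ^ 2 = c ^ 2 + 2 * ∫ τ in Ioc 0 t, F τ * U τ := by
  have hU' : ∀ᵐ τ ∂(volume : Measure ℝ), τ ∈ Ioo 0 T → U τ = c + ∫ r in Ioc 0 τ, F r :=
    (ae_restrict_iff' measurableSet_Ioo).1 hU
  filter_upwards [hU, ae_restrict_mem measurableSet_Ioo] with t ht htT
  have hsub : Ioc 0 t ⊆ Ioo 0 T := Ioc_subset_Ioo_right htT.2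
  rw [ht, sq_const_add_setIntegral_eq (hF.mono_set hsub)]
  congr 1
  congr 1
  refine setIntegral_congr_ae measurableSet_Ioc ?_
  filter_upwards [hU'] with τ hτ hτI
  rw [hτ (hsub hτI)]

omit [Fintype d] [DecidableEq d] in
/-- If `U = c + ∫_{(0,·]} F` a.e. with `F ∈ L¹(0,T)`, then `F U` is integrable on `(0,T)`. [folklore] -/
private theorem integrableOn_mul_of_ae_eq_add_setIntegral_V4 {T c : ℝ} {U F : ℝ → ℝ} (hF : IntegrableOn F (Ioo 0 T) volume)
    (hUm : AEStronglyMeasurable U (volume.restrict (Ioo 0 T)))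
    (hU : ∀ᵐ t ∂(volume.restrict (Ioo 0 T)), U t = c + ∫ τ in Ioc 0 t, F τ) :
    IntegrableOn (fun t => F t * U t) (Ioo 0 T) := by
  set B : ℝ := |c| + ∫ τ in Ioo 0 T, |F τ| with hB
  refine Integrable.mono' (hF.norm.mul_const B) (hF.aestronglyMeasurable.mul hUm) ?_
  filter_upwards [hU, ae_restrict_mem measurableSet_Ioo] with t ht htI
  rw [norm_mul, ht, Real.norm_eq_abs, Real.norm_eq_abs]
  refine mul_le_mul_of_nonneg_left ?_ (abs_nonneg _)
  calc |c + ∫ τ in Ioc 0 t, F τ| ≤ |c| + |∫ τ in Ioc 0 t, F τ| := abs_add_le _ _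
    _ ≤ |c| + ∫ τ in Ioc 0 t, |F τ| := by gcongr; exact abs_integral_le_integral_abs
    _ ≤ |c| + ∫ τ in Ioo 0 T, |F τ| :=
        add_le_add le_rfl (setIntegral_mono_set hF.abs (ae_of_all _ fun τ => abs_nonneg _)
          (Ioc_subset_Ioo_right htI.2).eventuallyLE)

omit [DecidableEq d] in
/-- Slices of an `L²(μ_T)` function are in `L²(T^d)` for a.e. `t ∈ (0,T)` (Tonelli). [folklore] -/
private theorem ae_memLp_two_slice_V4 {T : ℝ} {v : ℝ → UnitAddTorus d → EuclideanSpace ℝ d}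
    (hv : MemLp (uncurry v) 2 (((volume : Measure ℝ).restrict (Ioo 0 T)).prod (volume : Measure (UnitAddTorus d)))) :
    ∀ᵐ t ∂(volume.restrict (Ioo 0 T)), MemLp (v t) 2 volume := by
  have hm := hv.1
  have hfin : ∫⁻ p, ‖uncurry v p‖ₑ ^ 2 ∂(((volume : Measure ℝ).restrict (Ioo 0 T)).prod (volume : Measure (UnitAddTorus d))) < ⊤ := by
    have h2 := lintegral_rpow_enorm_lt_top_of_eLpNorm_lt_top two_ne_zero ENNReal.ofNat_ne_top hv.eLpNorm_lt_top
    simp only [ENNReal.toReal_ofNat, ENNReal.rpow_two] at h2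
    exact h2
  have hmeas : AEMeasurable (fun p : ℝ × UnitAddTorus d => ‖uncurry v p‖ₑ ^ 2)
      (((volume : Measure ℝ).restrict (Ioo 0 T)).prod (volume : Measure (UnitAddTorus d))) := hm.enorm.pow_const 2
  rw [lintegral_prod _ hmeas] at hfin
  filter_upwards [ae_lt_top' hmeas.lintegral_prod_right' hfin.ne, hm.prodMk_left] with t ht hmt
  refine ⟨hmt, ?_⟩
  rw [eLpNorm_eq_lintegral_rpow_enorm_toReal two_ne_zero ENNReal.ofNat_ne_top, ENNReal.toReal_ofNat]
  have e : ∫⁻ x, ‖v t x‖ₑ ^ (2 : ℝ) = ∫⁻ x, ‖v t x‖ₑ ^ 2 := lintegral_congr fun x => by rw [ENNReal.rpow_two]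
  rw [e]
  exact ENNReal.rpow_lt_top_of_nonneg (by norm_num) ht.ne

/-- **`L²ₜH¹ₓ` distributional solutions of the variable-tensor passive-vector equation are in `L^∞_t L²_x`.**
Let `w ∈ L²((0,T) × T^d)` have weakly divergence-free `L²` slices for a.e. `t` and weak space partial
derivatives `Gw t c` (`Torus.HasWeakPartialDeriv c (w t) (Gw t c)` for a.e. `t`, every `c`) with
`(t,x) ↦ Gw t c x ∈ L²(μ_T)`; let the carrier satisfy `‖b‖ ≤ M` a.e. with `b(t)` weakly divergence free
for a.e. `t`; let `w₀ ∈ L²` be weakly divergence free; `NearIso 𝔸 lo hi` with `lo > 0`; `𝔹` with smooth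
slices, `𝔹`, `∂_y𝔹` jointly continuous, `|𝔹 − 𝔸| ≤ δ` entrywise (`δ ≥ 0`); and let the weak formulation
hold against all divergence-free space–time tests (product form). Then for a.e. `t ∈ (0,T)`,
`∫‖w(t)‖² ≤ ∫‖w₀‖² + (4(dM)²/lo) ∫_{μ_T}‖w‖² + ((d²δ)²/lo) Σ_c ∫_{μ_T} ‖Gw c‖²` (first pass of the
truncated energy identity; Robinson–Rodrigo–Sadowski 2016, (4.20); the variable tensor through the
truncated Gårding inequality for `𝔸` plus the perturbation moved onto the weak gradient).
[cite: RobinsonRodrigoSadowski2016, §4.2 (4.20)] [cite: LionsMagenes1972, Chap. 3 Thm. 1.1 and §4.3] -/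
theorem ae_integral_norm_sq_le_of_weakVar {lo hi : ℝ} (h𝔸 : NearIso 𝔸 lo hi) (hlo : 0 < lo)
    (h𝔹s : ∀ t i c j e, FunctionSpaces.Torus.IsSmooth (fun y => 𝔹 t y i c j e))
    (h𝔹c : ∀ i c j e, Continuous (uncurry fun t y => 𝔹 t y i c j e))
    (h𝔹d : ∀ i c j e e', Continuous (uncurry fun t y =>
      FunctionSpaces.Torus.partialDeriv e' (fun y => 𝔹 t y i c j e) y))
    {δ : ℝ} (hδ0 : 0 ≤ δ) (hδ : ∀ t y i c j e, |𝔹 t y i c j e - 𝔸 i c j e| ≤ δ)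
    (hw2 : MemLp (uncurry w) 2 (((volume : Measure ℝ).restrict (Ioo 0 T)).prod volume))
    (hw2s : ∀ᵐ t ∂(volume.restrict (Ioo 0 T)), MemLp (w t) 2 volume)
    (hdivw : ∀ᵐ t ∂(volume.restrict (Ioo 0 T)), FunctionSpaces.Torus.IsWeaklyDivFree (w t))
    (hGw : ∀ᵐ t ∂(volume.restrict (Ioo 0 T)), ∀ c, FunctionSpaces.Torus.HasWeakPartialDeriv c (w t) (Gw t c))
    (hGw2 : ∀ c, MemLp (uncurry (Gw · c)) 2 (((volume : Measure ℝ).restrict (Ioo 0 T)).prod volume))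
    (hbm : AEStronglyMeasurable (uncurry b) (((volume : Measure ℝ).restrict (Ioo 0 T)).prod volume)) {M : ℝ}
    (hM : 0 ≤ M)
    (hbM : ∀ᵐ p ∂(((volume : Measure ℝ).restrict (Ioo 0 T)).prod (volume : Measure (UnitAddTorus d))), ‖uncurry b p‖ ≤ M)
    (hbdiv : ∀ᵐ t ∂(volume.restrict (Ioo 0 T)), FunctionSpaces.Torus.IsWeaklyDivFree (b t))
    (hweak : ∀ Ψ : ℝ → UnitAddTorus d → EuclideanSpace ℝ d, FunctionSpaces.Torus.IsSpaceTimeTest T Ψ →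
      (∀ t, FunctionSpaces.Torus.IsDivFree (Ψ t)) →
      (∫ p, ⟪w p.1 p.2, FunctionSpaces.Torus.timeDeriv Ψ p.1 p.2 +
          FunctionSpaces.Torus.convect (b p.1) (Ψ p.1) p.2 + viscAdjVar (𝔹 p.1) (Ψ p.1) p.2⟫_ℝ
          ∂(((volume : Measure ℝ).restrict (Ioo 0 T)).prod volume)) + ∫ x, ⟪w₀ x, Ψ 0 x⟫_ℝ = 0)
    (hw₀ : MemLp w₀ 2 volume) (hdiv₀ : FunctionSpaces.Torus.IsWeaklyDivFree w₀) :
    ∀ᵐ t ∂(volume.restrict (Ioo 0 T)),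
      ∫ x, ‖w t x‖ ^ 2 ≤ (∫ x, ‖w₀ x‖ ^ 2) +
        2 * (2 * (Fintype.card d * M) ^ 2 / lo) *
          ∫ p, ‖uncurry w p‖ ^ 2 ∂(((volume : Measure ℝ).restrict (Ioo 0 T)).prod volume) +
        2 * (((Fintype.card d : ℝ) ^ 2 * δ) ^ 2 / (2 * lo)) *
          ∑ c, ∫ p, ‖uncurry (Gw · c) p‖ ^ 2 ∂(((volume : Measure ℝ).restrict (Ioo 0 T)).prod volume) := by
  classical
  set μ : Measure (ℝ × UnitAddTorus d) := ((volume : Measure ℝ).restrict (Ioo 0 T)).prod volume with hμ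
  set C : ℝ := Fintype.card d * M with hC
  set κ : ℝ := ((Fintype.card d : ℝ) ^ 2 * δ) ^ 2 / (2 * lo) with hκ
  have hκ0 : 0 ≤ κ := by positivity
  -- ### integrability bookkeeping
  have hw1 : Integrable (uncurry w) μ := hw2.integrable one_le_two
  have hbw : Integrable (fun p : ℝ × UnitAddTorus d => ‖b p.1 p.2‖ * ‖w p.1 p.2‖) μ := by
    refine Integrable.mono' (hw1.norm.const_mul M) (hbm.norm.mul hw1.1.norm) ?_
    filter_upwards [hbM] with p hp
    rw [Real.norm_eq_abs, abs_of_nonneg (mul_nonneg (norm_nonneg _) (norm_nonneg _))]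
    exact mul_le_mul_of_nonneg_right hp (norm_nonneg _)
  have hbMt : ∀ᵐ t ∂(volume.restrict (Ioo 0 T)), ∀ᵐ x ∂volume, ‖b t x‖ ≤ M := Measure.ae_ae_of_ae_prod hbM
  have hbmt : ∀ᵐ t ∂(volume.restrict (Ioo 0 T)), AEStronglyMeasurable (b t) volume := hbm.prodMk_left
  have hGw2s : ∀ᵐ t ∂(volume.restrict (Ioo 0 T)), ∀ c, MemLp (Gw t c) 2 volume :=
    ae_all_iff.2 fun c => ae_memLp_two_slice_V4 (v := fun t x => Gw t c x) (hGw2 c)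
  -- good times: slices and products
  have hgood : ∀ᵐ t ∂(volume.restrict (Ioo 0 T)), MemLp (w t) 2 volume ∧ FunctionSpaces.Torus.IsWeaklyDivFree (w t) ∧
      Integrable (b t) volume ∧ FunctionSpaces.Torus.IsWeaklyDivFree (b t) ∧ (∀ᵐ x ∂volume, ‖b t x‖ ≤ M) ∧
      (∀ j, Integrable (fun x => b t x j • w t x) volume) ∧ (∀ j, Integrable (fun x => w t x j • b t x) volume) ∧
      (∀ c, FunctionSpaces.Torus.HasWeakPartialDeriv c (w t) (Gw t c)) ∧ (∀ c, MemLp (Gw t c) 2 volume) := by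
    filter_upwards [hw2s, hdivw, hbMt, hbmt, hbdiv, hGw, hGw2s] with t h2 hdw hbx hbs hbd hG hG2
    have hbint : Integrable (b t) volume := Integrable.of_bound hbs M hbx
    have hwi : Integrable (w t) volume := h2.integrable one_le_two
    refine ⟨h2, hdw, hbint, hbd, hbx, fun j => ?_, fun j => ?_, hG, hG2⟩
    · refine Integrable.mono' (hwi.norm.const_mul M)
        (((EuclideanSpace.proj j).continuous.comp_aestronglyMeasurable hbs).smul h2.1) ?_
      filter_upwards [hbx] with x hx
      rw [norm_smul]
      have hj : ‖b t x j‖ ≤ ‖b t x‖ := by simpa [Real.norm_eq_abs] using FunctionSpaces.Torus.abs_apply_le_norm (b t x) j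
      exact mul_le_mul (hj.trans hx) le_rfl (norm_nonneg _) hM
    · refine Integrable.mono' (hwi.norm.mul_const M)
        (((EuclideanSpace.proj j).continuous.comp_aestronglyMeasurable h2.1).smul hbs) ?_
      filter_upwards [hbx] with x hx
      rw [norm_smul]
      exact mul_le_mul (by simpa [Real.norm_eq_abs] using FunctionSpaces.Torus.abs_apply_le_norm (w t x) j) hx
        (norm_nonneg _) (norm_nonneg _)
  -- ### the frame and the coefficient functions
  set I : ℕ → Finset ((d → ℤ) × d × Bool) := fun N =>
    FunctionSpaces.Torus.freqBall N ×ˢ ((Finset.univ : Finset d) ×ˢ (Finset.univ : Finset Bool)) with hI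
  set a : (d → ℤ) × d × Bool → UnitAddTorus d → EuclideanSpace ℝ d := fun i => frameField i.1 i.2.1 i.2.2 with ha
  have ha_smooth : ∀ i, FunctionSpaces.Torus.IsSmooth (a i) := fun i => isSmooth_frameField _ _ _
  have ha_div : ∀ i, FunctionSpaces.Torus.IsDivFree (a i) := fun i => isDivFree_frameField' _ _ _
  have ha_cont : ∀ i, Continuous (a i) := fun i => continuous_frameField _ _ _
  set U : (d → ℤ) × d × Bool → ℝ → ℝ := fun i t => ∫ x, ⟪w t x, a i x⟫_ℝ with hU
  set φ : (d → ℤ) × d × Bool → ℝ → ℝ := fun i τ =>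
    ∫ x, ⟪w τ x, FunctionSpaces.Torus.convect (b τ) (a i) x + viscAdjVar (𝔹 τ) (a i) x⟫_ℝ with hφ
  have hslice := fun i => ae_integral_inner_eq_of_weakVar h𝔹s h𝔹c h𝔹d hw1 hbm hbw hweak (ha_smooth i) (ha_div i)
  have hφint : ∀ i, IntegrableOn (φ i) (Ioo 0 T) := fun i => (hslice i).1
  have hUm : ∀ i, AEStronglyMeasurable (U i) (volume.restrict (Ioo 0 T)) := by
    intro i
    have hc : Continuous (uncurry fun (_ : ℝ) (x : UnitAddTorus d) => a i x) := (ha_cont i).comp continuous_snd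
    exact (integrable_inner_of_integrable_of_continuous hw1 hc).integral_prod_left.aestronglyMeasurable
  -- the one-mode identities and their squares
  have hsq : ∀ i, ∀ᵐ t ∂(volume.restrict (Ioo 0 T)),
      U i t ^ 2 = (∫ x, ⟪w₀ x, a i x⟫_ℝ) ^ 2 + 2 * ∫ τ in Ioc 0 t, φ i τ * U i τ := fun i =>
    ae_sq_eq_of_ae_eq_add_setIntegral_V4 (hφint i) (hslice i).2
  have hφU : ∀ i, IntegrableOn (fun t => φ i t * U i t) (Ioo 0 T) := fun i =>
    integrableOn_mul_of_ae_eq_add_setIntegral_V4 (hφint i) (hUm i) (hslice i).2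
  -- ### the slice energy and the slice gradient energy are integrable in time
  have hE2 : IntegrableOn (fun s => ∫ x, ‖w s x‖ ^ 2) (Ioo 0 T) := (hw2.integrable_norm_pow two_ne_zero).integral_prod_left
  have hE2eq : ∫ s in Ioo 0 T, ∫ x, ‖w s x‖ ^ 2 = ∫ p, ‖uncurry w p‖ ^ 2 ∂μ := by
    rw [hμ, integral_prod _ (hw2.integrable_norm_pow two_ne_zero)]
    rfl
  set Gn : ℝ → ℝ := fun s => ∫ x, ∑ c, ‖Gw s c x‖ ^ 2 with hGn
  have hGsum : Integrable (fun p : ℝ × UnitAddTorus d => ∑ c, ‖uncurry (Gw · c) p‖ ^ 2) μ :=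
    integrable_finsetSum _ fun c _ => (hGw2 c).integrable_norm_pow two_ne_zero
  have hGnI : IntegrableOn Gn (Ioo 0 T) := hGsum.integral_prod_left
  have hGneq : ∫ s in Ioo 0 T, Gn s = ∑ c, ∫ p, ‖uncurry (Gw · c) p‖ ^ 2 ∂μ := by
    rw [← integral_finsetSum _ fun c _ => (hGw2 c).integrable_norm_pow two_ne_zero, hμ, integral_prod _ hGsum]
    rfl
  have hGn0 : ∀ s, 0 ≤ Gn s := fun s => integral_nonneg fun x => Finset.sum_nonneg fun _ _ => sq_nonneg _
  -- ### the summed integrand is bounded by `(2C²/lo) ∫‖w(τ)‖² + κ Gn τ`, a.e.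
  have hbound : ∀ N, ∀ᵐ τ ∂(volume.restrict (Ioo 0 T)),
      ∑ i ∈ I N, φ i τ * U i τ ≤ 2 * C ^ 2 / lo * (∫ x, ‖w τ x‖ ^ 2) + κ * Gn τ := by
    intro N
    filter_upwards [hgood] with τ hg
    obtain ⟨h2, hdw, hbint, hbd, hbx, hprod1, hprod2, hG, hG2⟩ := hg
    have hwi : Integrable (w τ) volume := h2.integrable one_le_two
    have h𝔹τ : ∀ i c j e, FunctionSpaces.Torus.IsSmooth (fun y => 𝔹 τ y i c j e) := h𝔹s τ
    -- the sum is the flux against the own truncation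
    have hsum : ∑ i ∈ I N, φ i τ * U i τ =
        ∫ x, ⟪w τ x, FunctionSpaces.Torus.convect (b τ) (FunctionSpaces.Torus.fourierTruncate N (w τ)) x +
          viscAdjVar (𝔹 τ) (FunctionSpaces.Torus.fourierTruncate N (w τ)) x⟫_ℝ := by
      calc ∑ i ∈ I N, φ i τ * U i τ
          = ∑ i ∈ I N, U i τ * ∫ x, ⟪w τ x, FunctionSpaces.Torus.convect (b τ) (a i) x + viscAdjVar (𝔹 τ) (a i) x⟫_ℝ := by
            refine Finset.sum_congr rfl fun i _ => ?_
            simp only [hφ]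
            ring
        _ = _ := sum_mul_varTensorFlux_eq (I N) (fun i => U i τ) ha_smooth h𝔹τ hwi hprod1
        _ = _ := by rw [fourierTruncate_eq_sum_integral_inner_smul_frameField h2 hdw N]
    have hPs := FunctionSpaces.Torus.isSmooth_fourierTruncate N (w τ)
    -- split transport / constant viscous part / perturbative viscous part
    have iC : Integrable (fun x => ⟪w τ x, FunctionSpaces.Torus.convect (b τ) (FunctionSpaces.Torus.fourierTruncate N (w τ)) x⟫_ℝ) volume :=
      integrable_inner_convect_of_integrable_smul hprod1 hPs
    have iA : Integrable (fun x => ⟪w τ x, viscAdj 𝔸 (FunctionSpaces.Torus.fourierTruncate N (w τ)) x⟫_ℝ) volume :=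
      FunctionSpaces.Torus.integrable_inner_of_continuous hwi (isSmooth_viscAdj 𝔸 hPs).continuous
    have hPτ : ∀ i c j e, FunctionSpaces.Torus.IsSmooth (fun y => (𝔹 τ y - 𝔸) i c j e) := fun i c j e => by
      simp only [Pi.sub_apply]
      exact (h𝔹τ i c j e).sub (FunctionSpaces.Torus.isSmooth_const _)
    have iP : Integrable (fun x => ⟪w τ x, viscAdjVar (fun y => 𝔹 τ y - 𝔸) (FunctionSpaces.Torus.fourierTruncate N (w τ)) x⟫_ℝ) volume :=
      FunctionSpaces.Torus.integrable_inner_of_continuous hwi (isSmooth_viscAdjVar hPτ hPs).continuous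
    have hsplit : ∫ x, ⟪w τ x, FunctionSpaces.Torus.convect (b τ) (FunctionSpaces.Torus.fourierTruncate N (w τ)) x +
          viscAdjVar (𝔹 τ) (FunctionSpaces.Torus.fourierTruncate N (w τ)) x⟫_ℝ =
        (∫ x, ⟪w τ x, FunctionSpaces.Torus.convect (b τ) (FunctionSpaces.Torus.fourierTruncate N (w τ)) x⟫_ℝ) +
          ((∫ x, ⟪w τ x, viscAdj 𝔸 (FunctionSpaces.Torus.fourierTruncate N (w τ)) x⟫_ℝ) +
            ∫ x, ⟪w τ x, viscAdjVar (fun y => 𝔹 τ y - 𝔸) (FunctionSpaces.Torus.fourierTruncate N (w τ)) x⟫_ℝ) := by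
      have e : ∀ x, ⟪w τ x, FunctionSpaces.Torus.convect (b τ) (FunctionSpaces.Torus.fourierTruncate N (w τ)) x +
          viscAdjVar (𝔹 τ) (FunctionSpaces.Torus.fourierTruncate N (w τ)) x⟫_ℝ =
          ⟪w τ x, FunctionSpaces.Torus.convect (b τ) (FunctionSpaces.Torus.fourierTruncate N (w τ)) x⟫_ℝ +
            (⟪w τ x, viscAdj 𝔸 (FunctionSpaces.Torus.fourierTruncate N (w τ)) x⟫_ℝ +
              ⟪w τ x, viscAdjVar (fun y => 𝔹 τ y - 𝔸) (FunctionSpaces.Torus.fourierTruncate N (w τ)) x⟫_ℝ) := by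
        intro x
        rw [viscAdjVar_eq_viscAdj_add h𝔹τ 𝔸 hPs x, inner_add_right, inner_add_right]
      have iAP : Integrable (fun x => ⟪w τ x, viscAdj 𝔸 (FunctionSpaces.Torus.fourierTruncate N (w τ)) x⟫_ℝ +
          ⟪w τ x, viscAdjVar (fun y => 𝔹 τ y - 𝔸) (FunctionSpaces.Torus.fourierTruncate N (w τ)) x⟫_ℝ) volume :=
        iA.add iP
      simp_rw [e]
      rw [integral_add iC iAP, integral_add iA iP]
    have hvisc := integral_inner_viscAdj_fourierTruncate_le h𝔸 h2 hdw N
    have hpert := abs_integral_inner_viscAdjVar_le_of_hasWeakPartialDeriv hPτ hδ0 (fun y => hδ τ y) hPs h2 hG hG2 hlo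
    rw [hsum, hsplit, integral_inner_convect_fourierTruncate_eq_remainder hbint hbd hprod1 N]
    -- the remainder bound and Young
    have hv : MemLp (fun x => w τ x - FunctionSpaces.Torus.fourierTruncate N (w τ) x) 2 volume :=
      h2.sub (FunctionSpaces.Torus.memLp_fourierTruncate N _ 2)
    have hR := abs_integral_inner_convect_le_of_norm_le (u := b τ) hv hM hbx
      (FunctionSpaces.Torus.isSmooth_fourierTruncate N (w τ))
    rw [gradNormSq_fourierTruncate] at hR
    rw [gradNormSq_fourierTruncate] at hpert
    set Rv := ∫ x, ⟪w τ x - FunctionSpaces.Torus.fourierTruncate N (w τ) x,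
      FunctionSpaces.Torus.convect (b τ) (FunctionSpaces.Torus.fourierTruncate N (w τ)) x⟫_ℝ with hRv
    set Pv := ∫ x, ⟪w τ x, viscAdjVar (fun y => 𝔹 τ y - 𝔸) (FunctionSpaces.Torus.fourierTruncate N (w τ)) x⟫_ℝ with hPv
    set tl := ∫ x, ‖w τ x - FunctionSpaces.Torus.fourierTruncate N (w τ) x‖ ^ 2 with htl
    set D := (FunctionSpaces.Torus.eGradNormSq (FunctionSpaces.Torus.fourierTruncate N (w τ))).toReal with hD
    have htl0 : 0 ≤ tl := integral_nonneg fun x => sq_nonneg _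
    have hD0 : 0 ≤ D := ENNReal.toReal_nonneg
    -- tail bound `tl ≤ 4 ∫‖w τ‖²`
    have htail : tl ≤ 4 * ∫ x, ‖w τ x‖ ^ 2 := by
      have hP : MemLp (FunctionSpaces.Torus.fourierTruncate N (w τ)) 2 volume := FunctionSpaces.Torus.memLp_fourierTruncate N _ 2
      have hpt : ∀ x, ‖w τ x - FunctionSpaces.Torus.fourierTruncate N (w τ) x‖ ^ 2 ≤
          2 * ‖w τ x‖ ^ 2 + 2 * ‖FunctionSpaces.Torus.fourierTruncate N (w τ) x‖ ^ 2 := fun x => by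
        have h1 : ‖w τ x - FunctionSpaces.Torus.fourierTruncate N (w τ) x‖ ^ 2 ≤
            (‖w τ x‖ + ‖FunctionSpaces.Torus.fourierTruncate N (w τ) x‖) ^ 2 :=
          pow_le_pow_left₀ (norm_nonneg _) (norm_sub_le _ _) 2
        nlinarith [h1, sq_nonneg (‖w τ x‖ - ‖FunctionSpaces.Torus.fourierTruncate N (w τ) x‖)]
      have i1 := h2.integrable_norm_pow two_ne_zero
      have i2 := hP.integrable_norm_pow two_ne_zero
      calc tl ≤ ∫ x, (2 * ‖w τ x‖ ^ 2 + 2 * ‖FunctionSpaces.Torus.fourierTruncate N (w τ) x‖ ^ 2) :=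
            integral_mono_of_nonneg (ae_of_all _ fun x => sq_nonneg _) ((i1.const_mul 2).add (i2.const_mul 2)) (ae_of_all _ hpt)
        _ = 2 * (∫ x, ‖w τ x‖ ^ 2) + 2 * (∫ x, ‖FunctionSpaces.Torus.fourierTruncate N (w τ) x‖ ^ 2) := by
            rw [integral_add (i1.const_mul 2) (i2.const_mul 2), integral_const_mul, integral_const_mul]
        _ ≤ 2 * (∫ x, ‖w τ x‖ ^ 2) + 2 * (∫ x, ‖w τ x‖ ^ 2) :=
            add_le_add le_rfl (mul_le_mul_of_nonneg_left (FunctionSpaces.Torus.integral_norm_sq_fourierTruncate_le h2 N) (by norm_num))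
        _ = 4 * ∫ x, ‖w τ x‖ ^ 2 := by ring
    -- Young for the transport remainder: `C √tl √D ≤ (lo/2) D + C² tl/(2lo)`
    have hyoung : C * Real.sqrt tl * Real.sqrt D ≤ lo / 2 * D + C ^ 2 / (2 * lo) * tl := by
      have h := young_sqrt_V4 (κ := C) (A := D) (B := tl) hlo hD0 htl0
      calc C * Real.sqrt tl * Real.sqrt D = C * Real.sqrt D * Real.sqrt tl := by ring
        _ ≤ lo / 2 * D + C ^ 2 / (2 * lo) * tl := h
    have hRle : Rv ≤ C * Real.sqrt tl * Real.sqrt D := (le_abs_self _).trans hR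
    have hPle : Pv ≤ lo / 2 * D + κ * Gn τ := (le_abs_self _).trans hpert
    calc Rv + ((∫ x, ⟪w τ x, viscAdj 𝔸 (FunctionSpaces.Torus.fourierTruncate N (w τ)) x⟫_ℝ) + Pv)
        ≤ C * Real.sqrt tl * Real.sqrt D + (-(lo * D) + (lo / 2 * D + κ * Gn τ)) := by linarith
      _ ≤ C ^ 2 / (2 * lo) * tl + κ * Gn τ := by linarith
      _ ≤ C ^ 2 / (2 * lo) * (4 * ∫ x, ‖w τ x‖ ^ 2) + κ * Gn τ :=
          add_le_add (mul_le_mul_of_nonneg_left htail (by positivity)) le_rfl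
      _ = 2 * C ^ 2 / lo * (∫ x, ‖w τ x‖ ^ 2) + κ * Gn τ := by ring
  -- ### assemble at a.e. `t`
  have hsq' : ∀ᵐ t ∂(volume.restrict (Ioo 0 T)), ∀ i,
      U i t ^ 2 = (∫ x, ⟪w₀ x, a i x⟫_ℝ) ^ 2 + 2 * ∫ τ in Ioc 0 t, φ i τ * U i τ := ae_all_iff.2 hsq
  have hbound' : ∀ N, ∀ᵐ τ ∂(volume : Measure ℝ), τ ∈ Ioo 0 T →
      ∑ i ∈ I N, φ i τ * U i τ ≤ 2 * C ^ 2 / lo * (∫ x, ‖w τ x‖ ^ 2) + κ * Gn τ := fun N =>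
    (ae_restrict_iff' measurableSet_Ioo).1 (hbound N)
  have h0 : ∀ N, ∑ i ∈ I N, (∫ x, ⟪w₀ x, a i x⟫_ℝ) ^ 2 ≤ ∫ x, ‖w₀ x‖ ^ 2 := by
    intro N
    have h := integral_inner_fourierTruncate_fourierTruncate_eq_sum hw₀ hw₀ hdiv₀ N
    have hB := FunctionSpaces.Torus.integral_norm_sq_fourierTruncate_le hw₀ N
    have e : ∫ x, ⟪FunctionSpaces.Torus.fourierTruncate N w₀ x, FunctionSpaces.Torus.fourierTruncate N w₀ x⟫_ℝ =
        ∫ x, ‖FunctionSpaces.Torus.fourierTruncate N w₀ x‖ ^ 2 :=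
      integral_congr_ae (ae_of_all _ fun x => real_inner_self_eq_norm_sq _)
    calc ∑ i ∈ I N, (∫ x, ⟪w₀ x, a i x⟫_ℝ) ^ 2 = ∑ i ∈ I N, (∫ x, ⟪w₀ x, a i x⟫_ℝ) * ∫ x, ⟪w₀ x, a i x⟫_ℝ :=
          Finset.sum_congr rfl fun i _ => sq _
      _ = ∫ x, ‖FunctionSpaces.Torus.fourierTruncate N w₀ x‖ ^ 2 := by rw [← h, e]
      _ ≤ ∫ x, ‖w₀ x‖ ^ 2 := hB
  have hRHSi : IntegrableOn (fun τ => 2 * C ^ 2 / lo * (∫ x, ‖w τ x‖ ^ 2) + κ * Gn τ) (Ioo 0 T) :=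
    (hE2.const_mul (2 * C ^ 2 / lo)).add (hGnI.const_mul κ)
  filter_upwards [hsq', hgood, ae_restrict_mem measurableSet_Ioo] with t ht hg htI
  obtain ⟨h2, hdw, -⟩ := hg
  have hsub : Ioc 0 t ⊆ Ioo 0 T := Ioc_subset_Ioo_right htI.2
  -- the truncated energies are bounded, uniformly in `N`
  have hEN : ∀ N, ∫ x, ⟪FunctionSpaces.Torus.fourierTruncate N (w t) x, FunctionSpaces.Torus.fourierTruncate N (w t) x⟫_ℝ ≤
      (∫ x, ‖w₀ x‖ ^ 2) + 2 * (2 * C ^ 2 / lo) * ∫ p, ‖uncurry w p‖ ^ 2 ∂μ +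
        2 * κ * ∑ c, ∫ p, ‖uncurry (Gw · c) p‖ ^ 2 ∂μ := by
    intro N
    rw [integral_inner_fourierTruncate_fourierTruncate_eq_sum h2 h2 hdw N]
    have hsumI' : IntegrableOn (fun τ => ∑ i ∈ I N, φ i τ * U i τ) (Ioo 0 T) :=
      integrable_finsetSum (I N) fun i _ => hφU i
    have hsumI : IntegrableOn (fun τ => ∑ i ∈ I N, φ i τ * U i τ) (Ioc 0 t) := hsumI'.mono_set hsub
    calc ∑ i ∈ I N, (U i t) * (U i t)
        = ∑ i ∈ I N, ((∫ x, ⟪w₀ x, a i x⟫_ℝ) ^ 2 + 2 * ∫ τ in Ioc 0 t, φ i τ * U i τ) :=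
          Finset.sum_congr rfl fun i _ => by rw [← sq, ht i]
      _ = (∑ i ∈ I N, (∫ x, ⟪w₀ x, a i x⟫_ℝ) ^ 2) + 2 * ∫ τ in Ioc 0 t, ∑ i ∈ I N, φ i τ * U i τ := by
          rw [Finset.sum_add_distrib, integral_finsetSum (I N) fun i _ => (hφU i).mono_set hsub, Finset.mul_sum]
      _ ≤ (∫ x, ‖w₀ x‖ ^ 2) + 2 * ∫ τ in Ioc 0 t, (2 * C ^ 2 / lo * (∫ x, ‖w τ x‖ ^ 2) + κ * Gn τ) := by
          refine add_le_add (h0 N) (mul_le_mul_of_nonneg_left ?_ (by norm_num))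
          refine integral_mono_ae hsumI (hRHSi.mono_set hsub) ?_
          exact (ae_restrict_iff' measurableSet_Ioc).2 ((hbound' N).mono fun τ hτ hτI => hτ (hsub hτI))
      _ ≤ (∫ x, ‖w₀ x‖ ^ 2) + 2 * ∫ τ in Ioo 0 T, (2 * C ^ 2 / lo * (∫ x, ‖w τ x‖ ^ 2) + κ * Gn τ) := by
          refine add_le_add le_rfl (mul_le_mul_of_nonneg_left ?_ (by norm_num))
          exact setIntegral_mono_set hRHSi
            (ae_of_all _ fun τ => add_nonneg (mul_nonneg (by positivity : (0 : ℝ) ≤ 2 * C ^ 2 / lo)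
              (integral_nonneg fun x => sq_nonneg _)) (mul_nonneg hκ0 (hGn0 τ))) hsub.eventuallyLE
      _ = (∫ x, ‖w₀ x‖ ^ 2) + 2 * (2 * C ^ 2 / lo) * ∫ p, ‖uncurry w p‖ ^ 2 ∂μ +
            2 * κ * ∑ c, ∫ p, ‖uncurry (Gw · c) p‖ ^ 2 ∂μ := by
          rw [integral_add (hE2.const_mul (2 * C ^ 2 / lo)) (hGnI.const_mul κ), integral_const_mul, integral_const_mul,
            hE2eq, hGneq]
          ring
  -- pass to the limit `N → ∞`
  exact le_of_tendsto' (tendsto_integral_inner_fourierTruncate_self h2) hEN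

end L2Bound

end Torus

end Literature.Analysis.FluidPDE

end
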